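import Mathlib
import HarnessLib
import Summits.Ventures.LatticeQCDFlow.Exactness.NCMCGeneralSpacePinskerFloor
import Summits.Ventures.LatticeQCDFlow.Scaling.AutoregressiveProposalKLChain
import Summits.Ventures.LatticeQCDFlow.Scaling.AutoregressiveProposalAffinityChain

/-!
# LatticeQCDFlow / Scaling — PINSKER ALONG THE ORDER: every summand of the KL chain rule dominates half
# the square of the conditional `L¹` error of the acceptance form, so the training loss of an
# autoregressive model is at least `½ Σ_k δ_k²`

HONEST FRAMING: exact (Metropolis-corrected) sampling algorithms for lattice gauge theory;
figures of merit are autocorrelation/cost numbers at stated couplings and volumes; no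
continuum-physics claim.

Venture `LatticeQCDFlow` (cell pub-lqcd), topic `Scaling`, FANOUT row 30 (lean-1, GEN-20) — OUR WORK on
THEORY-2.md §4 row C5: the bridge between the two currencies of the cell's autoregressive files — the
conditional `L¹` errors `δ_k = Z⁻¹∫|A_{s_k}F − q_{a_k}·A_{s_{k−1}}F| dπ` of
`Scaling/AutoregressiveProposalAcceptance{,Chain}` (necessity `ā ≤ 1 − max_k δ_k/4`, sufficiency
`ā ≥ (1 − ½Σ_kδ_k)²`) and the mean conditional divergences
`κ_k = ∫(F/Z) log(A_{s_k}F/(q_{a_k}A_{s_{k−1}}F)) dπ` of `Scaling/AutoregressiveProposalKLChain` (forward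
relative entropy `= Σ_k κ_k` exactly).

## What is proved (all [ours]; Pinsker 1964 / Csiszár 1967 NAMED, proved here in the form needed)

* §1 **`sq_integral_abs_sub_le_two_mul_integral_mul_log`** — Pinsker for two probability densities `p, q`
  (squeezed between positive constants) on a probability space: `(∫|p − q|)² ≤ 2∫ p log(p/q)` — the tree's
  pointwise linearisation `Exactness.GeneralNCMC.abs_one_sub_le_linear` integrated against `q`.
* §2 **`sq_integral_abs_condGap_le`** — PINSKER FOR ONE STEP: `π = ⊗_ι μ`, weight `F` squeezed between
  positive constants, `a ∉ s`, `q` squeezed, normalised in `a`, blind to `s`: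
  `(∫ |A_sF − q·A_{insert a s}F| dπ)² ≤ 2 (∫F dπ) ∫ F·log(A_sF/(q·A_{insert a s}F)) dπ`, i.e.
  `δ² ≤ 2κ` (Pinsker context by context for the exact conditional `A_sF(ω[a↦·])/A_{insert a s}F(ω)` against
  `q(ω[a↦·])`, then `2X ≤ tM + X²/(tM)` integrated and optimised in `t` — no Jensen step is needed).
* §3 **`sum_sq_condGap_le_two_mul_kl`** — along an autoregressive block of distinct coordinates,
  `Σ_k (∫|A_{s_k}F − q_{a_k}A_{s_{k−1}}F| dπ)² ≤ 2 Z² · ∫(F/Z) log((F/Z)/H_l) dπ` for the hybrid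
  `H_l = (∏_k q_{a_k})A_{s_0}F/Z`: **THE TRAINING LOSS IS AT LEAST `½ Σ_k δ_k²`**.

READING (value-free): the forward relative entropy — the population training loss of an autoregressive /
flow model up to the entropy constant — pays, ADDITIVELY along the generation order, at least half the
square of every conditional `L¹` error; wherever the cell's context floors force `δ_k ≥ δ` (a link whose
conditioner is blind at one endpoint, generated after its staple: `δ ≥ ⟨(1/N)Re tr U_p⟩_β`, every volume),
each such coordinate adds `≥ δ²/2` to the loss — an EXTENSIVE loss floor for architectures with `m` such
links (the gauge assembly is a separate file).  NOT CLAIMED: the reverse relative entropy; sharp constants;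
unbounded weights or proposals.  No `def`, no `sorry`, nothing cited as a fact.
-/

noncomputable section

namespace Summit.Ventures.LatticeQCDFlow.Theory2.Autoregressive

open MeasureTheory Function Set
open Summit.Ventures.LatticeQCDFlow.Exactness

/-! ## §1 Pinsker for two densities -/

/-- **Pinsker's inequality for two probability densities** squeezed between positive constants on a
probability space: `(∫ |p − q| dν)² ≤ 2 ∫ p·log(p/q) dν`. [Pinsker 1964; Csiszár 1967 — proved here] -/
theorem sq_integral_abs_sub_le_two_mul_integral_mul_log {Y : Type*} [MeasurableSpace Y] {ν : Measure Y}
    [IsProbabilityMeasure ν] {p q : Y → ℝ} (hpm : Measurable p) {cp Cp : ℝ} (hcp : 0 < cp)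
    (hplo : ∀ y, cp ≤ p y) (hphi : ∀ y, p y ≤ Cp) (hp1 : ∫ y, p y ∂ν = 1)
    (hqm : Measurable q) {cq Cq : ℝ} (hcq : 0 < cq) (hqlo : ∀ y, cq ≤ q y) (hqhi : ∀ y, q y ≤ Cq)
    (hq1 : ∫ y, q y ∂ν = 1) :
    (∫ y, |p y - q y| ∂ν) ^ 2 ≤ 2 * ∫ y, p y * Real.log (p y / q y) ∂ν := by
  have hp0 : ∀ y, 0 < p y := fun y => hcp.trans_le (hplo y)
  have hq0 : ∀ y, 0 < q y := fun y => hcq.trans_le (hqlo y)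
  have hu0 : ∀ y, 0 < p y / q y := fun y => div_pos (hp0 y) (hq0 y)
  have hbd : ∀ {f : Y → ℝ} (_ : Measurable f) {C : ℝ} (_ : ∀ y, |f y| ≤ C), Integrable f ν :=
    fun hf C hC => Integrable.mono' (integrable_const C) hf.aestronglyMeasurable
      (ae_of_all _ fun y => by rw [Real.norm_eq_abs]; exact hC y)
  have hpabs : ∀ y, |p y| ≤ Cp := fun y => by rw [abs_of_pos (hp0 y)]; exact hphi y
  have hqabs : ∀ y, |q y| ≤ Cq := fun y => by rw [abs_of_pos (hq0 y)]; exact hqhi y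
  have hpi : Integrable p ν := hbd hpm hpabs
  have hqi : Integrable q ν := hbd hqm hqabs
  have hulo : ∀ y, cp / Cq ≤ p y / q y := fun y =>
    (div_mem_bounds hcp hcq (hplo y) (hphi y) (hqlo y) (hqhi y)).1
  have huhi : ∀ y, p y / q y ≤ Cp / cq := fun y =>
    (div_mem_bounds hcp hcq (hplo y) (hphi y) (hqlo y) (hqhi y)).2
  have hlog : ∀ y, |Real.log (p y / q y)| ≤ Cp / cq + (cp / Cq)⁻¹ := fun y =>
    (Literature.NumberTheory.Automorphic.abs_log_le_add_inv (hu0 y)).trans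
      (add_le_add (huhi y) (inv_anti₀ (div_pos hcp (hcq.trans_le ((hqlo y).trans (hqhi y)))) (hulo y)))
  have hKm : Measurable fun y => p y * Real.log (p y / q y) :=
    hpm.mul (Real.measurable_log.comp (hpm.div hqm))
  have hKi : Integrable (fun y => p y * Real.log (p y / q y)) ν :=
    hbd hKm (C := Cp * (Cp / cq + (cp / Cq)⁻¹)) (fun y => by
      rw [abs_mul]
      exact mul_le_mul (hpabs y) (hlog y) (abs_nonneg _) ((abs_nonneg _).trans (hpabs y)))
  set X := ∫ y, |p y - q y| ∂ν with hX
  set K := ∫ y, p y * Real.log (p y / q y) ∂ν with hK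
  have hX0 : 0 ≤ X := integral_nonneg fun y => abs_nonneg _
  have hφ0 : ∀ y, 0 ≤ p y * Real.log (p y / q y) - p y + q y := by
    intro y
    have h := Literature.Computability.Complexity.RandomKSat.mul_log_sub_ge_neg_one (hu0 y).le
    have hqne : q y ≠ 0 := (hq0 y).ne'
    have e : p y * Real.log (p y / q y) - p y + q y
        = q y * (p y / q y * Real.log (p y / q y) - p y / q y + 1) := by
      field_simp
    rw [e]
    exact mul_nonneg (hq0 y).le h
  have hI1 : Integrable (fun y => p y * Real.log (p y / q y) - p y) ν := hKi.sub hpi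
  have hφi : Integrable (fun y => p y * Real.log (p y / q y) - p y + q y) ν := hI1.add hqi
  have hφ : ∫ y, (p y * Real.log (p y / q y) - p y + q y) ∂ν = K := by
    rw [integral_add hI1 hqi, integral_sub hKi hpi, hp1, hq1, hK]
    ring
  have hK0 : 0 ≤ K := by rw [← hφ]; exact integral_nonneg hφ0
  -- `X ≤ t + K/(2t)` for every `t > 0`
  have hlin : ∀ t : ℝ, 0 < t → X ≤ t + K / (2 * t) := by
    intro t ht
    have hA : Integrable (fun y => t * ((4 * q y + 2 * p y) / 3)) ν :=
      (((hqi.const_mul 4).add (hpi.const_mul 2)).div_const 3).const_mul t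
    have hB : Integrable (fun y => (p y * Real.log (p y / q y) - p y + q y) / t) ν := hφi.div_const t
    have hpt : ∀ y, |p y - q y| ≤
        (t * ((4 * q y + 2 * p y) / 3) + (p y * Real.log (p y / q y) - p y + q y) / t) / 2 := by
      intro y
      have hqne : q y ≠ 0 := (hq0 y).ne'
      have htne : t ≠ 0 := ht.ne'
      have h := mul_le_mul_of_nonneg_left (GeneralNCMC.abs_one_sub_le_linear (hu0 y).le ht) (hq0 y).le
      have e1 : q y * |1 - p y / q y| = |p y - q y| := by
        rw [show p y - q y = -(q y * (1 - p y / q y)) by field_simp; ring, abs_neg, abs_mul,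
          abs_of_pos (hq0 y)]
      have e2 : q y * ((t * ((4 + 2 * (p y / q y)) / 3)
            + (p y / q y * Real.log (p y / q y) - p y / q y + 1) / t) / 2)
          = (t * ((4 * q y + 2 * p y) / 3) + (p y * Real.log (p y / q y) - p y + q y) / t) / 2 := by
        field_simp
      rw [e1, e2] at h
      exact h
    have hle : X ≤ ∫ y, (t * ((4 * q y + 2 * p y) / 3)
        + (p y * Real.log (p y / q y) - p y + q y) / t) / 2 ∂ν :=
      integral_mono_of_nonneg (ae_of_all _ fun y => abs_nonneg _) ((hA.add hB).div_const 2)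
        (ae_of_all _ hpt)
    have hval : ∫ y, (t * ((4 * q y + 2 * p y) / 3)
        + (p y * Real.log (p y / q y) - p y + q y) / t) / 2 ∂ν = t + K / (2 * t) := by
      rw [integral_div, integral_add hA hB, integral_const_mul, integral_div, integral_div,
        integral_add (hqi.const_mul 4) (hpi.const_mul 2), integral_const_mul, integral_const_mul, hp1, hq1,
        hφ]
      field_simp
      ring
    rw [hval] at hle
    exact hle
  rcases hX0.eq_or_lt with hX00 | hXpos
  · rw [← hX00]
    simpa using hK0
  · have h := hlin (X / 2) (by positivity)
    rw [show K / (2 * (X / 2)) = K / X by ring_nf] at h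
    have h3 : X / 2 ≤ K / X := by linarith
    rw [le_div_iff₀ hXpos] at h3
    nlinarith [h3]

/-! ## §2 Pinsker for one autoregressive step -/

variable {ι : Type*} [Fintype ι] [DecidableEq ι] {X : Type*} [MeasurableSpace X]
variable (μ : Measure X) [IsProbabilityMeasure μ]

/-- **PINSKER FOR ONE STEP: `δ² ≤ 2κ`.**  `π = ⊗_ι μ`; weight `F` measurable with `0 < c_F ≤ F ≤ C_F`;
`a ∉ s`; `q` measurable with `0 < c_q ≤ q ≤ C_q`, normalised in `a`, blind to the coordinates of `s`.
Then `(∫ |A_sF − q·A_{insert a s}F| dπ)² ≤ 2 (∫ F dπ) · ∫ F·log(A_sF/(q·A_{insert a s}F)) dπ`. [ours] -/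
theorem sq_integral_abs_condGap_le (s : Finset ι) {a : ι} (ha : a ∉ s) {F q : (ι → X) → ℝ}
    (hFm : Measurable F) {cF CF : ℝ} (hcF : 0 < cF) (hFlo : ∀ ω, cF ≤ F ω) (hFhi : ∀ ω, F ω ≤ CF)
    (hqm : Measurable q) {cq Cq : ℝ} (hcq : 0 < cq) (hqlo : ∀ ω, cq ≤ q ω) (hqhi : ∀ ω, q ω ≤ Cq)
    (hq1 : ∀ ω, ∫ v, q (update ω a v) ∂μ = 1) (hqs : ∀ ω ω', q (s.piecewise ω' ω) = q ω) :
    (∫ ω, |coordAvg μ s F ω - q ω * coordAvg μ (insert a s) F ω| ∂Measure.pi (fun _ : ι => μ)) ^ 2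
      ≤ 2 * (∫ ω, F ω ∂Measure.pi (fun _ : ι => μ)) *
        ∫ ω, F ω * Real.log (coordAvg μ s F ω / (q ω * coordAvg μ (insert a s) F ω))
          ∂Measure.pi (fun _ : ι => μ) := by
  set N := coordAvg μ s F with hN
  set M := coordAvg μ (insert a s) F with hM
  have hF0 : ∀ ω, 0 < F ω := fun ω => hcF.trans_le (hFlo ω)
  have hFabs : ∀ ω, |F ω| ≤ CF := fun ω => by rw [abs_of_pos (hF0 ω)]; exact hFhi ω
  have hq0 : ∀ ω, 0 < q ω := fun ω => hcq.trans_le (hqlo ω)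
  have hqabs : ∀ ω, |q ω| ≤ Cq := fun ω => by rw [abs_of_pos (hq0 ω)]; exact hqhi ω
  have hNf := fun ω => coordAvg_pos_of_le μ s hFm hcF hFlo hFhi ω
  have hMf := fun ω => coordAvg_pos_of_le μ (insert a s) hFm hcF hFlo hFhi ω
  have hNm : Measurable N := measurable_coordAvg μ s hFm
  have hMm : Measurable M := measurable_coordAvg μ (insert a s) hFm
  have hNb : ∀ ω, |N ω| ≤ CF := abs_coordAvg_le_of_abs_le μ s hFm hFabs
  have hMb : ∀ ω, |M ω| ≤ CF := abs_coordAvg_le_of_abs_le μ (insert a s) hFm hFabs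
  have hMa : ∀ ω v, M (update ω a v) = M ω := fun ω v => coordAvg_insert_update μ s a F ω v
  have ω₀ : ι → X := fun _ => (MeasureTheory.nonempty_of_isProbabilityMeasure μ).some
  have hCF : 0 < CF := (hF0 ω₀).trans_le (hFhi ω₀)
  have hCq : 0 < Cq := (hq0 ω₀).trans_le (hqhi ω₀)
  -- the ratio `R = N/(qM)` is squeezed; `log R` is bounded, measurable, blind to `s`
  set R : (ι → X) → ℝ := fun ω => N ω / (q ω * M ω) with hR
  have hRm : Measurable R := hNm.div (hqm.mul hMm)
  have hR0 : ∀ ω, 0 < R ω := fun ω => div_pos (hNf ω).1 (mul_pos (hq0 ω) (hMf ω).1)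
  have hRlo : ∀ ω, cF / (Cq * CF) ≤ R ω := fun ω =>
    (div_mem_bounds hcF (mul_pos hcq hcF) (hNf ω).2.1 (hNf ω).2.2
      (mul_le_mul (hqlo ω) (hMf ω).2.1 hcF.le (hq0 ω).le)
      (mul_le_mul (hqhi ω) (hMf ω).2.2 (hMf ω).1.le hCq.le)).1
  have hRhi : ∀ ω, R ω ≤ CF / (cq * cF) := fun ω =>
    (div_mem_bounds hcF (mul_pos hcq hcF) (hNf ω).2.1 (hNf ω).2.2
      (mul_le_mul (hqlo ω) (hMf ω).2.1 hcF.le (hq0 ω).le)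
      (mul_le_mul (hqhi ω) (hMf ω).2.2 (hMf ω).1.le hCq.le)).2
  have hlo_pos : 0 < cF / (Cq * CF) := div_pos hcF (mul_pos hCq hCF)
  set B : ℝ := CF / (cq * cF) + (cF / (Cq * CF))⁻¹ with hB
  have hlogm : Measurable fun ω => Real.log (R ω) := Real.measurable_log.comp hRm
  have hlogb : ∀ ω, |Real.log (R ω)| ≤ B := fun ω =>
    (Literature.NumberTheory.Automorphic.abs_log_le_add_inv (hR0 ω)).trans
      (add_le_add (hRhi ω) (inv_anti₀ hlo_pos (hRlo ω)))
  have hMs : ∀ ω ω', M (s.piecewise ω' ω) = M ω := by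
    intro ω ω'
    have e : (insert a s).piecewise ω' (s.piecewise ω' ω) = (insert a s).piecewise ω' ω :=
      Finset.piecewise_piecewise_of_subset_right (Finset.subset_insert a s) _ _ _
    rw [hM, ← coordAvg_apply_piecewise μ (insert a s) F (s.piecewise ω' ω) ω', e, coordAvg_apply_piecewise]
  have hlogs : ∀ ω ω', Real.log (R (s.piecewise ω' ω)) = Real.log (R ω) := by
    intro ω ω'
    simp only [hR, hN, coordAvg_apply_piecewise, hqs]
    rw [hMs]
  -- (i) `∫ F log R = ∫ N log R`
  have hstep1 : ∫ ω, F ω * Real.log (R ω) ∂Measure.pi (fun _ : ι => μ)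
      = ∫ ω, N ω * Real.log (R ω) ∂Measure.pi (fun _ : ι => μ) := by
    have e := pi_integral_mul_coordAvg μ s hFm hFabs hlogm hlogb hlogs
    rw [show (fun ω => F ω * Real.log (R ω)) = fun ω => Real.log (R ω) * F ω from funext fun _ => mul_comm _ _,
      show (fun ω => N ω * Real.log (R ω)) = fun ω => Real.log (R ω) * N ω from funext fun _ => mul_comm _ _]
    exact e
  -- (ii) the per-context quantities: `h = N log R`, `D = |N − qM|`
  set h : (ι → X) → ℝ := fun ω => N ω * Real.log (R ω) with hh
  have hhm : Measurable h := hNm.mul hlogm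
  have hhb : ∀ ω, |h ω| ≤ CF * B := fun ω => by
    rw [hh]; dsimp only; rw [abs_mul]
    exact mul_le_mul (hNb ω) (hlogb ω) (abs_nonneg _) ((abs_nonneg _).trans (hNb ω))
  set D : (ι → X) → ℝ := fun ω => |N ω - q ω * M ω| with hD
  have hDm : Measurable D := (hNm.sub (hqm.mul hMm)).abs
  have hD0 : ∀ ω, 0 ≤ D ω := fun ω => abs_nonneg _
  have hDb : ∀ ω, |D ω| ≤ CF + Cq * CF := fun ω => by
    rw [hD]; dsimp only; rw [abs_abs]
    calc |N ω - q ω * M ω| ≤ |N ω| + |q ω * M ω| := abs_sub _ _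
      _ ≤ CF + Cq * CF := by
          rw [abs_mul]
          exact add_le_add (hNb ω) (mul_le_mul (hqabs ω) (hMb ω) (abs_nonneg _)
            ((abs_nonneg _).trans (hqabs ω)))
  -- (iii) PINSKER CONTEXT BY CONTEXT: `(A_a D)(ω)² ≤ 2 M(ω) (A_a h)(ω)`
  have hctx : ∀ ω, (coordAvg μ {a} D ω) ^ 2 ≤ 2 * M ω * coordAvg μ {a} h ω := by
    intro ω
    have hM0 : 0 < M ω := (hMf ω).1
    -- the two densities on `(X, μ)`
    set p : X → ℝ := fun v => N (update ω a v) / M ω with hp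
    set qv : X → ℝ := fun v => q (update ω a v) with hqv
    have hpm : Measurable p := (hNm.comp (measurable_update ω)).div_const _
    have hqvm : Measurable qv := hqm.comp (measurable_update ω)
    have hplo : ∀ v, cF / CF ≤ p v := fun v =>
      (div_mem_bounds hcF hcF (hNf _).2.1 (hNf _).2.2 (hMf ω).2.1 (hMf ω).2.2).1
    have hphi : ∀ v, p v ≤ CF / cF := fun v =>
      (div_mem_bounds hcF hcF (hNf _).2.1 (hNf _).2.2 (hMf ω).2.1 (hMf ω).2.2).2
    have hp1 : ∫ v, p v ∂μ = 1 := by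
      rw [hp]; dsimp only
      rw [integral_div, hN, ← coordAvg_insert_eq_integral_coordAvg_update μ ha hFm hFabs ω, ← hM]
      exact div_self hM0.ne'
    have hpins := sq_integral_abs_sub_le_two_mul_integral_mul_log hpm (div_pos hcF hCF) hplo hphi hp1
      hqvm hcq (fun v => hqlo _) (fun v => hqhi _) (hq1 ω)
    -- identify the two integrals
    have eD : coordAvg μ {a} D ω = M ω * ∫ v, |p v - qv v| ∂μ := by
      rw [coordAvg_singleton_of_measurable μ a hDm ω, ← integral_const_mul]
      refine integral_congr_ae (ae_of_all _ fun v => ?_)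
      rw [hD, hp, hqv]; dsimp only
      have hMne : M ω ≠ 0 := hM0.ne'
      have e3 : N (update ω a v) - q (update ω a v) * M (update ω a v)
          = M ω * (N (update ω a v) / M ω - q (update ω a v)) := by
        rw [hMa ω v]
        field_simp
      rw [e3, abs_mul, abs_of_pos hM0]
    have eh : coordAvg μ {a} h ω = M ω * ∫ v, p v * Real.log (p v / qv v) ∂μ := by
      rw [coordAvg_singleton_of_measurable μ a hhm ω, ← integral_const_mul]
      refine integral_congr_ae (ae_of_all _ fun v => ?_)
      rw [hh, hR, hp, hqv]; dsimp only
      have hMne : M ω ≠ 0 := hM0.ne'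
      rw [hMa ω v]
      have e2 : N (update ω a v) / (q (update ω a v) * M ω) = N (update ω a v) / M ω / q (update ω a v) := by
        ring
      rw [e2]
      field_simp
    rw [eD, eh, mul_pow]
    have := mul_le_mul_of_nonneg_left hpins (sq_nonneg (M ω))
    calc M ω ^ 2 * (∫ v, |p v - qv v| ∂μ) ^ 2 ≤ M ω ^ 2 * (2 * ∫ v, p v * Real.log (p v / qv v) ∂μ) := this
      _ = 2 * M ω * (M ω * ∫ v, p v * Real.log (p v / qv v) ∂μ) := by ring
  -- (iv) integrate: `2 ∫ A_a D ≤ t Z + (2/t) ∫ A_a h` for every `t > 0`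
  have hADm : Measurable (coordAvg μ {a} D) := measurable_coordAvg μ {a} hDm
  have hADb : ∀ ω, |coordAvg μ {a} D ω| ≤ CF + Cq * CF := abs_coordAvg_le_of_abs_le μ {a} hDm hDb
  have hAhm : Measurable (coordAvg μ {a} h) := measurable_coordAvg μ {a} hhm
  have hAhb : ∀ ω, |coordAvg μ {a} h ω| ≤ CF * B := abs_coordAvg_le_of_abs_le μ {a} hhm hhb
  have hADi : Integrable (coordAvg μ {a} D) (Measure.pi fun _ : ι => μ) := integrable_pi_of_abs_le μ hADm hADb
  have hAhi : Integrable (coordAvg μ {a} h) (Measure.pi fun _ : ι => μ) := integrable_pi_of_abs_le μ hAhm hAhb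
  have hMi : Integrable M (Measure.pi fun _ : ι => μ) := integrable_pi_of_abs_le μ hMm hMb
  set Z : ℝ := ∫ ω, F ω ∂Measure.pi (fun _ : ι => μ) with hZ
  set XD : ℝ := ∫ ω, coordAvg μ {a} D ω ∂Measure.pi (fun _ : ι => μ) with hXD
  set KH : ℝ := ∫ ω, coordAvg μ {a} h ω ∂Measure.pi (fun _ : ι => μ) with hKH
  have eZ : ∫ ω, M ω ∂Measure.pi (fun _ : ι => μ) = Z := pi_integral_coordAvg μ (insert a s) hFm hFabs
  have eXD : XD = ∫ ω, |N ω - q ω * M ω| ∂Measure.pi (fun _ : ι => μ) := pi_integral_coordAvg μ {a} hDm hDb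
  have eKH : KH = ∫ ω, F ω * Real.log (R ω) ∂Measure.pi (fun _ : ι => μ) := by
    rw [hKH, pi_integral_coordAvg μ {a} hhm hhb, hstep1]
  have hKH0 : 0 ≤ KH := by
    rw [hKH]
    refine integral_nonneg fun ω => ?_
    have h1 : 0 ≤ 2 * M ω * coordAvg μ {a} h ω := (sq_nonneg _).trans (hctx ω)
    exact (mul_nonneg_iff_of_pos_left (mul_pos two_pos (hMf ω).1)).1 h1
  have hlin : ∀ t : ℝ, 0 < t → 2 * XD ≤ t * Z + 2 / t * KH := by
    intro t ht
    have hpt : ∀ ω, 2 * coordAvg μ {a} D ω ≤ t * M ω + 2 / t * coordAvg μ {a} h ω := by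
      intro ω
      have hM0 : 0 < M ω := (hMf ω).1
      have htM : 0 < t * M ω := mul_pos ht hM0
      have hMne : M ω ≠ 0 := hM0.ne'
      have htne : t ≠ 0 := ht.ne'
      have k1 : 2 * coordAvg μ {a} D ω ≤ t * M ω + (coordAvg μ {a} D ω) ^ 2 / (t * M ω) := by
        have e : t * M ω + (coordAvg μ {a} D ω) ^ 2 / (t * M ω) - 2 * coordAvg μ {a} D ω
            = (t * M ω - coordAvg μ {a} D ω) ^ 2 / (t * M ω) := by
          field_simp
          ring
        have : 0 ≤ (t * M ω - coordAvg μ {a} D ω) ^ 2 / (t * M ω) := div_nonneg (sq_nonneg _) htM.le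
        linarith
      have k2 : (coordAvg μ {a} D ω) ^ 2 / (t * M ω) ≤ 2 / t * coordAvg μ {a} h ω := by
        rw [div_le_iff₀ htM]
        have := hctx ω
        calc (coordAvg μ {a} D ω) ^ 2 ≤ 2 * M ω * coordAvg μ {a} h ω := this
          _ = 2 / t * coordAvg μ {a} h ω * (t * M ω) := by field_simp
      linarith
    have hI : ∫ ω, 2 * coordAvg μ {a} D ω ∂Measure.pi (fun _ : ι => μ)
        ≤ ∫ ω, (t * M ω + 2 / t * coordAvg μ {a} h ω) ∂Measure.pi (fun _ : ι => μ) :=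
      integral_mono (hADi.const_mul 2) ((hMi.const_mul t).add (hAhi.const_mul (2 / t))) hpt
    rw [integral_const_mul, integral_add (hMi.const_mul t) (hAhi.const_mul (2 / t)), integral_const_mul,
      integral_const_mul, eZ] at hI
    exact hI
  have hXD0 : 0 ≤ XD := integral_nonneg fun ω => (coordAvg_mem_Icc μ {a} hDm hD0 (fun ω => (le_abs_self _).trans (hDb ω)) ω).1
  have hZpos : 0 < Z := by
    have h1 : ∫ _, cF ∂Measure.pi (fun _ : ι => μ) ≤ ∫ ω, M ω ∂Measure.pi (fun _ : ι => μ) :=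
      integral_mono (integrable_const cF) hMi fun ω => (hMf ω).2.1
    have h2 : ∫ _, cF ∂Measure.pi (fun _ : ι => μ) = cF := by
      rw [integral_const, smul_eq_mul, Measure.real, measure_univ, ENNReal.toReal_one, one_mul]
    rw [← eZ]
    linarith
  have hgoal : XD ^ 2 ≤ 2 * Z * KH := by
    rcases hXD0.eq_or_lt with h0 | hpos
    · rw [← h0, zero_pow two_ne_zero]; positivity
    · have h := hlin (XD / Z) (div_pos hpos hZpos)
      have e1 : XD / Z * Z = XD := div_mul_cancel₀ XD hZpos.ne'
      have e2 : 2 / (XD / Z) * KH = 2 * Z * KH / XD := by field_simp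
      rw [e1, e2] at h
      have h3 : XD ≤ 2 * Z * KH / XD := by linarith
      rw [le_div_iff₀ hpos] at h3
      rw [sq]
      exact h3
  rw [eXD, eKH] at hgoal
  simpa only [hR, hD] using hgoal

/-! ## §3 Along the order: the training loss is at least `½ Σ_k δ_k²` -/

/-- **`Σ_k (∫|A_{s_k}F − q_{a_k}·A_{s_{k−1}}F| dπ)² ≤ 2 Z² · KL(target ‖ hybrid)`.**  Weight `F` and
conditionals `q_a` squeezed between positive constants, `q_a` normalised in `a`, the block `l` of distinct
coordinates autoregressive; `H_l = (∏_k q_{a_k})·A_{s_0}F/Z`.  With `δ_k` the conditional `L¹` errors in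
units of `Z`, the forward relative entropy satisfies `∫ (F/Z) log((F/Z)/H_l) dπ ≥ ½ Σ_k δ_k²`. [ours] -/
theorem sum_sq_condGap_le_two_mul_kl {q : ι → (ι → X) → ℝ} (hqm : ∀ a, Measurable (q a))
    {cq Cq : ℝ} (hcq : 0 < cq) (hqlo : ∀ a ω, cq ≤ q a ω) (hqhi : ∀ a ω, q a ω ≤ Cq)
    (hq1 : ∀ a ω, ∫ v, q a (update ω a v) ∂μ = 1)
    {F : (ι → X) → ℝ} (hFm : Measurable F) {cF CF : ℝ} (hcF : 0 < cF) (hFlo : ∀ ω, cF ≤ F ω)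
    (hFhi : ∀ ω, F ω ≤ CF) (l : List ι) (hl : l.Nodup)
    (hpw : l.Pairwise (fun a b => ∀ ω v, q a (update ω b v) = q a ω)) :
    ((l.zip l.tails.tail).map fun c : ι × List ι =>
        (∫ ω, |coordAvg μ c.2.toFinset F ω - q c.1 ω * coordAvg μ (c.1 :: c.2).toFinset F ω|
          ∂Measure.pi (fun _ : ι => μ)) ^ 2).sum
      ≤ 2 * (∫ ω, F ω ∂Measure.pi (fun _ : ι => μ)) ^ 2 *
        ∫ ω, F ω / (∫ η, F η ∂Measure.pi (fun _ : ι => μ)) *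
          Real.log ((F ω / ∫ η, F η ∂Measure.pi (fun _ : ι => μ)) /
            ((l.map fun b => q b ω).prod * coordAvg μ l.toFinset F ω / ∫ η, F η ∂Measure.pi (fun _ : ι => μ)))
          ∂Measure.pi (fun _ : ι => μ) := by
  set Z : ℝ := ∫ η, F η ∂Measure.pi (fun _ : ι => μ) with hZ
  have hF0 : ∀ ω, 0 < F ω := fun ω => hcF.trans_le (hFlo ω)
  have hFabs : ∀ ω, |F ω| ≤ CF := fun ω => by rw [abs_of_pos (hF0 ω)]; exact hFhi ω
  have hZpos : 0 < Z := by
    have h1 : ∫ _, cF ∂Measure.pi (fun _ : ι => μ) ≤ Z :=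
      integral_mono (integrable_const cF) (integrable_pi_of_abs_le μ hFm hFabs) hFlo
    have h2 : ∫ _, cF ∂Measure.pi (fun _ : ι => μ) = cF := by
      rw [integral_const, smul_eq_mul, Measure.real, measure_univ, ENNReal.toReal_one, one_mul]
    linarith
  rw [integral_kl_arHybrid_eq_sum μ hqm hcq hqlo hqhi hFm hcF hFlo hFhi l, ← List.sum_map_mul_left]
  refine List.sum_le_sum fun c hc => ?_
  have hnot : c.1 ∉ c.2.toFinset := by
    rw [List.mem_toFinset]
    exact fun hb => rel_of_mem_zip_tails (R := fun a b => a ≠ b) l hl c hc c.1 hb rfl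
  have hblind : ∀ ω ω', q c.1 (c.2.toFinset.piecewise ω' ω) = q c.1 ω :=
    blind_piecewise_of_forall_update c.2 (rel_of_mem_zip_tails l hpw c hc)
  have hstep := sq_integral_abs_condGap_le μ c.2.toFinset hnot hFm hcF hFlo hFhi (hqm c.1) hcq
    (hqlo c.1) (hqhi c.1) (hq1 c.1) hblind
  rw [← hZ] at hstep
  have hZne : Z ≠ 0 := hZpos.ne'
  rw [List.toFinset_cons]
  -- `∫ F log R = Z ∫ (F/Z) log R`
  have e : ∫ ω, F ω * Real.log (coordAvg μ c.2.toFinset F ω /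
        (q c.1 ω * coordAvg μ (insert c.1 c.2.toFinset) F ω)) ∂Measure.pi (fun _ : ι => μ)
      = Z * ∫ ω, F ω / Z * Real.log (coordAvg μ c.2.toFinset F ω /
        (q c.1 ω * coordAvg μ (insert c.1 c.2.toFinset) F ω)) ∂Measure.pi (fun _ : ι => μ) := by
    rw [← integral_const_mul]
    refine integral_congr_ae (ae_of_all _ fun ω => ?_)
    field_simp
  rw [e] at hstep
  calc _ ≤ _ := hstep
    _ = _ := by ring

end Summit.Ventures.LatticeQCDFlow.Theory2.Autoregressive

end
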